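import Mathlib.Tactic.Ring
import Mathlib.Data.Real.Basic
import Mathlib.Algebra.BigOperators.Ring.Finset
import HarnessLib

/-!
# Conjecture N (hodge-weil ladder, GAPS G51b): on a single null line the charge-zero class-test quantity vanishes identically

Prover 2, generation 10 (note `run/shared/lean/b2b/hodge-weil/b2b-hweil-pv2-g10/CROSS-MAX-G10.md` §1.3, §3.2). Companion of
`Literature/AlgebraicGeometry/HodgeTheory/WeilClassTestNullCone.lean` (generation 9; the statement below is the `μ₁₀μ₀₁ = 0` case of its
`cross_G0_identity`, seen directly and without any purity or sign hypothesis). Pure algebra over an arbitrary finite index type; nothing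
here is a rung, a door edge or a cited fact; no statement of Markman's papers is used. New (unpublished) cell result, hence under Summits/.
-/

set_option linter.dupNamespace false

namespace Summit.HodgeConjecture.HodgeConjecture.WeilClassTestSingleNullLine

open Finset BigOperators

/-! If every root lies on ONE null line through the vertex — in centred coordinates `u_k − ū = A_k − Ā` for all `k` (all roots on
`{M = M*}`; the case `{P = P*}` is `u_k − ū = −(A_k − Ā)`) — then `Q₄ = −Q₂` term by term, so `G₀ = Q₂ + Q₄ = 0` with NO purity
or sign hypothesis and for any finite index type. This is the `μ₁₀μ₀₁ = 0` case of `cross_G0_identity` seen directly; together with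
`WeilClassTestFormatThreeOne` / note `b2b-hweil-pv2-g10/CROSS-MAX-G10.md` §1.3 (a PURE single-line configuration is degenerate) it
explains the `R = 1`, `0/0` points of the generation-9 scans and why every Putinar certificate for Conjecture N must vanish on the two
single-line faces (note §3.2). -/

/-- SINGLE NULL LINE `{M = M*}`: if `u_k − ū = A_k − Ā` for every root then `Q₂ + Q₄ = 0` identically. -/
theorem singleNullLine_G0_eq_zero {ι : Type*} [Fintype ι] (ε A u : ι → ℝ) (Ab ub : ℝ)
    (hline : ∀ k, u k - ub = A k - Ab) :
    1 / 2 * (∑ k, ε k * (A k - Ab) ^ 2) * (∑ k, ε k * (u k - ub) ^ 2)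
        + (∑ k, ε k * (A k - Ab) * (u k - ub)) ^ 2 - 3 * (∑ k, ε k * (A k - Ab) ^ 2 * (u k - ub) ^ 2)
        + (3 * (∑ k, ε k * (u k - ub) ^ 4) - 3 / 2 * (∑ k, ε k * (u k - ub) ^ 2) ^ 2) = 0 := by
  have e1 : (∑ k, ε k * (u k - ub) ^ 2) = ∑ k, ε k * (A k - Ab) ^ 2 :=
    Finset.sum_congr rfl (fun k _ => by rw [hline k])
  have e2 : (∑ k, ε k * (A k - Ab) * (u k - ub)) = ∑ k, ε k * (A k - Ab) ^ 2 :=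
    Finset.sum_congr rfl (fun k _ => by rw [hline k]; ring)
  have e3 : (∑ k, ε k * (A k - Ab) ^ 2 * (u k - ub) ^ 2) = ∑ k, ε k * (A k - Ab) ^ 4 :=
    Finset.sum_congr rfl (fun k _ => by rw [hline k]; ring)
  have e4 : (∑ k, ε k * (u k - ub) ^ 4) = ∑ k, ε k * (A k - Ab) ^ 4 :=
    Finset.sum_congr rfl (fun k _ => by rw [hline k])
  rw [e1, e2, e3, e4]
  ring

/-- SINGLE NULL LINE `{P = P*}`: if `u_k − ū = −(A_k − Ā)` for every root then `Q₂ + Q₄ = 0` identically. -/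
theorem singleNullLine_G0_eq_zero' {ι : Type*} [Fintype ι] (ε A u : ι → ℝ) (Ab ub : ℝ)
    (hline : ∀ k, u k - ub = -(A k - Ab)) :
    1 / 2 * (∑ k, ε k * (A k - Ab) ^ 2) * (∑ k, ε k * (u k - ub) ^ 2)
        + (∑ k, ε k * (A k - Ab) * (u k - ub)) ^ 2 - 3 * (∑ k, ε k * (A k - Ab) ^ 2 * (u k - ub) ^ 2)
        + (3 * (∑ k, ε k * (u k - ub) ^ 4) - 3 / 2 * (∑ k, ε k * (u k - ub) ^ 2) ^ 2) = 0 := by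
  have e1 : (∑ k, ε k * (u k - ub) ^ 2) = ∑ k, ε k * (A k - Ab) ^ 2 :=
    Finset.sum_congr rfl (fun k _ => by rw [hline k]; ring)
  have e2 : (∑ k, ε k * (A k - Ab) * (u k - ub)) = -∑ k, ε k * (A k - Ab) ^ 2 := by
    rw [← Finset.sum_neg_distrib]; exact Finset.sum_congr rfl (fun k _ => by rw [hline k]; ring)
  have e3 : (∑ k, ε k * (A k - Ab) ^ 2 * (u k - ub) ^ 2) = ∑ k, ε k * (A k - Ab) ^ 4 :=
    Finset.sum_congr rfl (fun k _ => by rw [hline k]; ring)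
  have e4 : (∑ k, ε k * (u k - ub) ^ 4) = ∑ k, ε k * (A k - Ab) ^ 4 :=
    Finset.sum_congr rfl (fun k _ => by rw [hline k]; ring)
  rw [e1, e2, e3, e4]
  ring

end Summit.HodgeConjecture.HodgeConjecture.WeilClassTestSingleNullLine
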